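import Literature.NumberTheory.Sieve.QuadraticRootsLevelGeometry
import HarnessLib

/-!
# The involution `[A, B, C] ↦ [−A, B, −C]` on level forms (`Δ > 0`: the two orientations)

Topic `Literature/NumberTheory/Sieve`, a complement to `QuadraticRootsLevelForms.lean` and
`QuadraticRootsLevelGeometry.lean` for Tóth's positive-discriminant case.  A `Γ₀(q)`-class of
level forms of positive discriminant contains forms of both signs of `A`, while the Weyl sums only
count those with `A > 0` (`RootForms.levelFormsUpTo`).  The involution
`Q = [A, B, C] ↦ Q♭ = [−A, B, −C]` (conjugation by `diag(1, −1)`) explains the bookkeeping: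

* `flat`, `flat_flat`, `flat_disc`, **`isLevelForm_flat_iff`**, **`isTReduced_flat_iff`** — `♭`
  is a bijection between the `T`-reduced level forms with `A < 0` and those with `A > 0` (same
  level, same residue class `B ≡ b (mod 2a)`, same discriminant);
* **`herm_flat`**: `herm Q♭ z = −herm Q (ρ z)` with `ρ(x + iy) = −x + iy`, hence
  **`mem_geod_flat_iff`**: the geodesic of `Q♭` is the reflection of that of `Q` in the imaginary
  axis.  Consequently an orbital weight `∫_{S_Q} φ ds` built from a kernel `φ` on `ℍ` takes the same
  value on `Q♭` as the weight of the reflected kernel `φ ∘ ρ` on `Q`: summed over a whole class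
  (both signs of `A`) only the `ρ`-even part of `φ` survives — with `φ = e(hx)Ψ(y)` one obtains the
  cosine (real-part) Weyl sums, and the sine part requires an orientation-sensitive functional
  (recorded here as the reason the positive-discriminant case needs more than the weight-zero
  Poincaré series of DFI).

Everything here is proved.

## References

* Á. Tóth, *Roots of quadratic congruences*, IMRN 2000, no. 14, 719–739 (positive discriminant;
  cite-only in the store, cf. [cite: Ngo2024, §1]). [cite: Toth2000, main theorem]
* W. Duke, J. B. Friedlander, H. Iwaniec, Ann. of Math. (2) 141 (1995), §2 (negative
  discriminant, where all forms of a class have `A > 0`). [cite: DukeFriedlanderIwaniec1995, §2 p. 427]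
-/

noncomputable section

namespace Literature.NumberTheory.Sieve

open scoped MatrixGroups UpperHalfPlane
open Literature.NumberTheory.QuadraticFields.Quadratic (BinQF)
open UpperHalfPlane

namespace RootForms

/-! ### The involution `♭` -/

/-- `Q♭ = [−A, B, −C]` (`Q♭(x, y) = −Q(x, −y)`). [folklore] -/
def flat (Q : BinQF) : BinQF := ⟨-Q.a, Q.b, -Q.c⟩

/-- Coefficients of `Q♭`. [folklore] -/
@[simp] theorem flat_a (Q : BinQF) : (flat Q).a = -Q.a := rfl

/-- Coefficients of `Q♭`. [folklore] -/
@[simp] theorem flat_b (Q : BinQF) : (flat Q).b = Q.b := rfl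

/-- Coefficients of `Q♭`. [folklore] -/
@[simp] theorem flat_c (Q : BinQF) : (flat Q).c = -Q.c := rfl

/-- `♭` is an involution. [folklore] -/
@[simp] theorem flat_flat (Q : BinQF) : flat (flat Q) = Q := by
  ext <;> simp [flat]

/-- `♭` is injective. [folklore] -/
theorem flat_injective : Function.Injective flat := fun Q Q' h => by
  rw [← flat_flat Q, h, flat_flat]

/-- `♭` preserves the discriminant. [folklore] -/
@[simp] theorem flat_disc (Q : BinQF) : (flat Q).disc = Q.disc := by
  simp only [BinQF.disc, flat_a, flat_b, flat_c]; ring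

/-- `Q♭(x, y) = −Q(x, −y)`. [folklore] -/
theorem flat_eval (Q : BinQF) (x y : ℤ) : (flat Q).eval x y = -Q.eval x (-y) := by
  simp only [BinQF.eval, flat_a, flat_b, flat_c]; ring

/-- **`♭` preserves the level set** (same discriminant, `q ∣ −A`, same `B`). [folklore] -/
theorem isLevelForm_flat_iff {a b Δ : ℤ} {q : ℕ} {Q : BinQF} :
    IsLevelForm a b Δ q (flat Q) ↔ IsLevelForm a b Δ q Q := by
  constructor
  · intro h
    exact ⟨by simpa using h.disc_eq, by simpa using h.level_dvd, by simpa using h.mid_dvd⟩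
  · intro h
    exact ⟨by simpa using h.disc_eq, by simpa using h.level_dvd, by simpa using h.mid_dvd⟩

/-- **`♭` preserves `T`-reducedness** (`0 ≤ B < 2|A|` only involves `|A|`). [folklore] -/
theorem isTReduced_flat_iff {Q : BinQF} : IsTReduced (flat Q) ↔ IsTReduced Q := by
  simp only [IsTReduced, flat_a, flat_b, abs_neg]

/-- `♭` exchanges the signs of `A`. [folklore] -/
theorem flat_a_pos_iff {Q : BinQF} : 0 < (flat Q).a ↔ Q.a < 0 := by
  simp only [flat_a, Left.neg_pos_iff]

/-- **`♭` is a bijection from the `T`-reduced level forms with `A < 0` onto those with `A > 0`**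
(an `Equiv` of subtypes). [folklore] -/
def flatEquiv (a b Δ : ℤ) (q : ℕ) :
    {Q : BinQF // IsLevelForm a b Δ q Q ∧ Q.a < 0 ∧ IsTReduced Q} ≃
      {Q : BinQF // IsLevelForm a b Δ q Q ∧ 0 < Q.a ∧ IsTReduced Q} where
  toFun Q := ⟨flat Q.1, isLevelForm_flat_iff.2 Q.2.1, flat_a_pos_iff.2 Q.2.2.1,
    isTReduced_flat_iff.2 Q.2.2.2⟩
  invFun Q := ⟨flat Q.1, isLevelForm_flat_iff.2 Q.2.1, by
    have := Q.2.2.1; simp only [flat_a]; linarith, isTReduced_flat_iff.2 Q.2.2.2⟩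
  left_inv Q := Subtype.ext (flat_flat Q.1)
  right_inv Q := Subtype.ext (flat_flat Q.1)

/-! ### `♭` and the geodesic: reflection in the imaginary axis -/

/-- The reflection `ρ(x + iy) = −x + iy` of the complex plane (`= −conj z`). [folklore] -/
def reflectC (z : ℂ) : ℂ := -(starRingEnd ℂ z)

/-- Real part of `ρ z`. [folklore] -/
@[simp] theorem reflectC_re (z : ℂ) : (reflectC z).re = -z.re := by simp [reflectC]

/-- Imaginary part of `ρ z`. [folklore] -/
@[simp] theorem reflectC_im (z : ℂ) : (reflectC z).im = z.im := by simp [reflectC]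

/-- `ρ` preserves the upper half-plane. [folklore] -/
def reflect (z : ℍ) : ℍ := ⟨reflectC z, by rw [reflectC_im]; exact z.im_pos⟩

/-- The underlying complex number of `reflect z`. [folklore] -/
@[simp] theorem coe_reflect (z : ℍ) : ((reflect z : ℍ) : ℂ) = reflectC z := rfl

/-- `ρ` is an involution on `ℍ`. [folklore] -/
@[simp] theorem reflect_reflect (z : ℍ) : reflect (reflect z) = z := by
  apply UpperHalfPlane.ext
  apply Complex.ext <;> simp

/-- **`herm Q♭ z = −herm Q (ρ z)`.** [folklore] -/
theorem herm_flat (Q : BinQF) (z : ℂ) : herm (flat Q) z = -herm Q (reflectC z) := by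
  simp only [herm, flat_a, flat_b, flat_c, Complex.normSq_apply, reflectC_re, reflectC_im]
  push_cast
  ring

/-- **The geodesic of `Q♭` is the reflection of that of `Q`**: `z ∈ S_{Q♭} ↔ ρ z ∈ S_Q`.
[cite: Toth2000, main theorem (closed geodesics; cf. Ngo2024 §1)] -/
theorem mem_geod_flat_iff (Q : BinQF) (z : ℍ) : z ∈ geod (flat Q) ↔ reflect z ∈ geod Q := by
  rw [mem_geod, mem_geod, herm_flat, coe_reflect, neg_eq_zero]

/-- Equivalently `S_{Q♭} = ρ(S_Q)`. [folklore] -/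
theorem geod_flat (Q : BinQF) : geod (flat Q) = reflect ⁻¹' geod Q := by
  ext z; exact mem_geod_flat_iff Q z

end RootForms

end Literature.NumberTheory.Sieve
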